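import Literature.Computability.Cryptography.PeriodFindingSums
import Literature.Computability.Cryptography.PeriodFindingCircuit
import Literature.Computability.Cryptography.ShorOrderFindingQuantum
import HarnessLib

/-!
# Period finding by eigenvalue estimation of shifts, III: the read-out law of the shift experiment

Family `PQC` / quantum-advantage barrier `PPolyOracles`; third file towards the discharge of
`Literature.Barriers.QuantumAdvantage.aaronsonChen2017_lem75_quantum` (Aaronson–Chen 2017,
Lemma 7.5 (2)–(3), App. 13: Boneh–Lipton period finding). We combine the amplitudes of the
sandwich circuit `H_{y,Z}; V; S³; H_y` (`PeriodFindingCircuit.lean`) with the autocorrelation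
form of Parseval (`PeriodFindingSums.lean`) into the **law of the control read-out** of the shift
experiment (Kitaev 1995, §3–§4 for the eigenvalue experiment; Shor 1997, §5 for the coset
weights): if the classical block writes, for every unit `u` (block length `L_u`, modulus
`Q_u = 2^{L_u}`, table `F_u`), the table value `F_u (Z_u − A_u(y) mod Q_u)` of the offset shifted
by the exponent `A_u(y) = ∑_{unit j = u} y_j 2^{lev j}` of its controls, then the probability of
a control read-out `γ` is
`∑_c (∏_u unitWeight_u (c_u)) ∏_j testWeight (γ_j) (σ_j) (2π c_{unit j} 2^{lev j} / Q_{unit j})`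
— a mixture over character vectors `c` (unit `u` drawing `c_u` with probability
`corrMass_u (c_u) / Q_u²`) of independent Hadamard tests with the exact phases `c_u / Q_u`.

* `Qof`, `unitWeight` (`= corrMass / Q²`; a probability vector: `unitWeight_nonneg`,
  `sum_unitWeight`; `unitWeight_of_injOn` = `1/Q`; `unitWeight_periodic` = Shor's
  `∑_{k<a} outcomeProb Q a k c`), `lawAngle`, `readWeight`;
* `norm_sq_charSum` — the factorisation `|2^{-k₁} ∑_y (-i)^{#σ∧y}(-1)^{y·γ} χ_c(A(y))|² =
  ∏_j testWeight …` (Kitaev 1995, §3, Remark 8 and Lemma 8);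
* **`sandwich_law`** — the read-out law above, relative to any oracle `A`.

## References

* A. Yu. Kitaev, arXiv:quant-ph/9511026 (1995), §3 (Remark 8, Lemma 8, Lemma 10), §4 [Kitaev1995].
* P. W. Shor, SIAM J. Comput. 26 (1997) 1484–1509, §5 [Shor1997].
* D. Boneh, R. J. Lipton, CRYPTO '95, LNCS 963 (1995) 424–437 [BonehLipton1995].
* S. Aaronson, L. Chen, CCC 2017 (arXiv:1612.05903), Lemma 7.5, App. 13 [AaronsonChen2017].
-/

noncomputable section

namespace Literature.Computability.Cryptography

namespace PeriodFinding

open _root_.Computability Complexity QuantumComplexity Matrix Finset Kitaev1995 Complex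

/-! ### The weights of the character mixture -/

section weights

variable {U : Type*} {Ω : Type*} [DecidableEq Ω]

/-- The modulus `Q_u = 2^{L_u}` of unit `u` (block length `L_u`). [folklore] -/
def Qof (Lu : U → ℕ) (u : U) : ℕ := 2 ^ Lu u

/-- Moduli are positive. [folklore] -/
theorem Qof_pos (Lu : U → ℕ) (u : U) : 0 < Qof Lu u := Nat.two_pow_pos _

/-- **The weight of the character `c` at unit `u`**: `corrMass_u (c) / Q_u²` (Shor 1997, §5:
for a periodic table the probability of observing `c`; Kitaev 1995, §4: the weight of the
eigenvalue index). [cite: Shor1997, §5 (probability of observing |c, x^k mod n>)] -/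
def unitWeight (Lu : U → ℕ) (F : U → ℕ → Ω) (u : U) (c : ℕ) : ℝ :=
  corrMass (Qof Lu u) (F u) c / ((Qof Lu u : ℝ) ^ 2)

/-- Weights are nonnegative. [folklore] -/
theorem unitWeight_nonneg (Lu : U → ℕ) (F : U → ℕ → Ω) (u : U) (c : ℕ) :
    0 ≤ unitWeight Lu F u c :=
  div_nonneg (corrMass_nonneg _ _ _) (by positivity)

/-- **Weights are a probability vector on `[0, Q_u)`.** [folklore] -/
theorem sum_unitWeight (Lu : U → ℕ) (F : U → ℕ → Ω) (u : U) :
    ∑ c ∈ range (Qof Lu u), unitWeight Lu F u c = 1 := by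
  unfold unitWeight
  have hQ : (0 : ℝ) < (Qof Lu u : ℝ) ^ 2 := by
    have := Qof_pos Lu u
    positivity
  rw [← sum_div, sum_corrMass _ (Qof_pos Lu u), div_self hQ.ne']

/-- **An injective table gives the uniform weights `1/Q_u`.** [folklore] -/
theorem unitWeight_of_injOn (Lu : U → ℕ) (F : U → ℕ → Ω) (u : U)
    (hF : Set.InjOn (F u) (range (Qof Lu u) : Set ℕ)) (c : ℕ) :
    unitWeight Lu F u c = 1 / (Qof Lu u : ℝ) := by
  unfold unitWeight
  rw [corrMass_of_injOn _ _ hF]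
  have := Qof_pos Lu u
  field_simp

/-- **A periodic table gives Shor's outcome probabilities**: if `F_u v = g (v mod a)` with `g`
injective on `[0, a)` and `0 < a ≤ Q_u`, then `unitWeight_u (c) = ∑_{k<a} outcomeProb Q_u a k c`.
[cite: Shor1997, §5 (probability of observing |c, x^k mod n>)] -/
theorem unitWeight_periodic (Lu : U → ℕ) (F : U → ℕ → Ω) (u : U) {a : ℕ} (ha : 0 < a)
    (haQ : a ≤ Qof Lu u) (g : ℕ → Ω) (hg : Set.InjOn g (range a : Set ℕ))
    (hF : ∀ v, F u v = g (v % a)) (c : ℕ) :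
    unitWeight Lu F u c = ∑ k ∈ range a, Shor1997.outcomeProb (Qof Lu u) a k c := by
  unfold unitWeight
  rw [show F u = fun v => g (v % a) from funext hF, corrMass_periodic _ _ ha haQ g hg]
  have hQ : (0 : ℝ) < (Qof Lu u : ℝ) ^ 2 := by
    have := Qof_pos Lu u
    positivity
  exact mul_div_cancel_left₀ _ hQ.ne'

end weights

/-! ### The angles and the read-out weights -/

section angles

variable {k₁ : ℕ} {U : Type*}

/-- The test angle of control `j` under the character vector `c`:
`2π c_{unit j} 2^{lev j} / Q_{unit j}` (Kitaev 1995, §3, Lemma 10: control `j` tests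
`U^{2^{lev j}}`, eigenphase `c/Q`). [cite: Kitaev1995, §3 (Lemma 10)] -/
def lawAngle (Lu : U → ℕ) (un : Fin k₁ → U) (lev : Fin k₁ → ℕ) (c : (u : U) → Fin (Qof Lu u))
    (j : Fin k₁) : ℝ :=
  2 * Real.pi * ((c (un j) : ℕ) : ℝ) * 2 ^ lev j / (Qof Lu (un j))

/-- The weight of the read-out `γ` given the character vector `c`: independent Hadamard tests.
[cite: Kitaev1995, §3 (Remark 8, Lemma 8)] -/
def readWeight (Lu : U → ℕ) (un : Fin k₁ → U) (lev : Fin k₁ → ℕ) (σ : Fin k₁ → Bool)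
    (c : (u : U) → Fin (Qof Lu u)) (γ : QReg k₁) : ℝ :=
  ∏ j, testWeight (γ j) (σ j) (lawAngle Lu un lev c j)

/-- Read-out weights are nonnegative. [folklore] -/
theorem readWeight_nonneg (Lu : U → ℕ) (un : Fin k₁ → U) (lev : Fin k₁ → ℕ) (σ : Fin k₁ → Bool)
    (c : (u : U) → Fin (Qof Lu u)) (γ : QReg k₁) : 0 ≤ readWeight Lu un lev σ c γ :=
  prod_nonneg fun _ _ => testWeight_nonneg _ _ _

/-- **Read-out weights are a probability vector.** [folklore] -/
theorem sum_readWeight (Lu : U → ℕ) (un : Fin k₁ → U) (lev : Fin k₁ → ℕ) (σ : Fin k₁ → Bool)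
    (c : (u : U) → Fin (Qof Lu u)) : ∑ γ : QReg k₁, readWeight Lu un lev σ c γ = 1 :=
  sum_prodWeight (fun j b => testWeight b (σ j) (lawAngle Lu un lev c j)) fun j =>
    testWeight_false_add_true (σ j) _

end angles

/-! ### The factorisation of the character sums -/

section factorisation

variable {k₁ : ℕ} {U : Type*} [Fintype U] [DecidableEq U]

/-- The character of the shift experiment at the exponent vector of `y`, in the shape of
`Kitaev1995.sum_prod_mul_exp_eq_prod` (with denominator `1` and unit-dependent slopes `c_u/Q_u`).
[folklore] -/
theorem chrPi_trialExp (Lu : U → ℕ) (un : Fin k₁ → U) (lev : Fin k₁ → ℕ)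
    (c : (u : U) → Fin (Qof Lu u)) (y : QReg k₁) :
    chrPi (Qof Lu) c (fun u => (trialExp un lev u y : ℤ)) =
      cexp (2 * Real.pi * I * ((∑ u, ((c u : ℕ) : ℂ) / (Qof Lu u : ℂ) *
        ∑ j ∈ univ.filter (fun j => un j = u), (((y j).toNat * 2 ^ lev j : ℕ) : ℂ)) / (1 : ℕ))) := by
  unfold chrPi
  congr 1
  rw [Nat.cast_one, div_one]
  congr 1
  refine sum_congr rfl fun u _ => ?_
  simp only [trialExp]
  push_cast
  ring

/-- **Factorisation of the character sum of the shift experiment** (Kitaev 1995, §3, Remark 8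
and Lemma 8): `|2^{-k₁} ∑_y (-i)^{#σ∧y} (-1)^{y·γ} χ_c(A(y))|² = ∏_j testWeight (γ_j) (σ_j) θ_j`,
`θ_j = 2π c_{unit j} 2^{lev j} / Q_{unit j}`. [cite: Kitaev1995, §3 (Remark 8, Lemma 8)] -/
theorem norm_sq_charSum (Lu : U → ℕ) (un : Fin k₁ → U) (lev : Fin k₁ → ℕ) (σ : Fin k₁ → Bool)
    (c : (u : U) → Fin (Qof Lu u)) (γ : QReg k₁) :
    ((1 / 2 : ℝ) ^ k₁) ^ 2 * ‖∑ y : QReg k₁, (sPhase σ y * ySign y γ) *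
        chrPi (Qof Lu) c (fun u => (trialExp un lev u y : ℤ))‖ ^ 2 =
      readWeight Lu un lev σ c γ := by
  classical
  set χ : Fin k₁ → Bool → ℂ := fun j b =>
    if b then (if γ j then (-1 : ℂ) else 1) * (if σ j then -I else 1) else 1 with hχ
  -- absorb the constant into the sum
  have hconst : ((1 / 2 : ℝ) ^ k₁) ^ 2 * ‖∑ y : QReg k₁, (sPhase σ y * ySign y γ) *
      chrPi (Qof Lu) c (fun u => (trialExp un lev u y : ℤ))‖ ^ 2 =
      ‖∑ y : QReg k₁, ((1 / 2 : ℂ) ^ k₁ * ∏ j, χ j (y j)) *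
        chrPi (Qof Lu) c (fun u => (trialExp un lev u y : ℤ))‖ ^ 2 := by
    have h1 : ∀ y : QReg k₁, ((1 / 2 : ℂ) ^ k₁ * ∏ j, χ j (y j)) *
        chrPi (Qof Lu) c (fun u => (trialExp un lev u y : ℤ)) =
        (1 / 2 : ℂ) ^ k₁ * ((sPhase σ y * ySign y γ) *
          chrPi (Qof Lu) c (fun u => (trialExp un lev u y : ℤ))) := by
      intro y
      rw [sPhase_mul_ySign, hχ]
      ring
    rw [sum_congr rfl fun y _ => h1 y, ← mul_sum, norm_mul, mul_pow, norm_pow, norm_div,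
      norm_one, Complex.norm_ofNat]
  rw [hconst]
  -- factorise the character sum
  have hfac : (∑ y : QReg k₁, ((1 / 2 : ℂ) ^ k₁ * ∏ j, χ j (y j)) *
      chrPi (Qof Lu) c (fun u => (trialExp un lev u y : ℤ))) =
      ∏ j, (1 + χ j true * cexp (2 * Real.pi * I *
        (((c (un j) : ℕ) : ℂ) / (Qof Lu (un j) : ℂ) * 2 ^ lev j / (1 : ℕ)))) / 2 := by
    have h1 : ∀ y : QReg k₁, ((1 / 2 : ℂ) ^ k₁ * ∏ j, χ j (y j)) *
        chrPi (Qof Lu) c (fun u => (trialExp un lev u y : ℤ)) =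
        (1 / 2 : ℂ) ^ k₁ * ((∏ j, χ j (y j)) * cexp (2 * Real.pi * I *
          ((∑ u, ((c u : ℕ) : ℂ) / (Qof Lu u : ℂ) *
            ∑ j ∈ univ.filter (fun j => un j = u), (((y j).toNat * 2 ^ lev j : ℕ) : ℂ)) /
              (1 : ℕ)))) := by
      intro y
      rw [chrPi_trialExp, mul_assoc]
    rw [sum_congr rfl fun y _ => h1 y, ← mul_sum,
      sum_prod_mul_exp_eq_prod 1 un lev χ fun u => ((c u : ℕ) : ℂ) / (Qof Lu u : ℂ),
      prod_div_distrib, prod_const, card_univ, Fintype.card_fin]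
    have hχ0 : ∀ j, χ j false = 1 := fun j => by simp [hχ]
    simp_rw [hχ0]
    rw [one_div, inv_pow, ← div_eq_inv_mul]
  rw [hfac, norm_prod, ← prod_pow, readWeight]
  refine prod_congr rfl fun j _ => ?_
  have := norm_sq_testAmplitude (γ j) (σ j) (lawAngle Lu un lev c j)
  rw [testWeight, ← this, hχ]
  congr 3
  simp only [if_true]
  rw [lawAngle]
  push_cast
  ring_nf

end factorisation

/-! ### The read-out law -/

section law

variable {n k₁ k₂ m : ℕ} {U Ω : Type*} [Fintype U] [DecidableEq U] [DecidableEq Ω]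

/-- The offset register is the product of the unit registers and the junk register:
`2^{k₂} = (∏_u Q_u) · |J|`. [folklore] -/
theorem two_pow_eq_prod_Qof {J : Type*} [Fintype J] (Lu : U → ℕ)
    (zv : QReg k₂ ≃ ((u : U) → Fin (Qof Lu u)) × J) :
    (2 : ℝ) ^ k₂ = (∏ u, (Qof Lu u : ℝ)) * Fintype.card J := by
  have h := Fintype.card_congr zv
  rw [Fintype.card_fun, Fintype.card_bool, Fintype.card_fin, Fintype.card_prod,
    Fintype.card_pi] at h
  simp only [Fintype.card_fin] at h
  exact_mod_cast h

/-- **The law of the control read-out of the shift experiment.** Units `u` with block lengths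
`L_u` (moduli `Q_u = 2^{L_u}`) and tables `F_u`; controls `j < k₁` with unit `un j`, level
`lev j` and type `σ j`; the offset register identified by `zv` with `∏_u [0, Q_u)` times a junk
register `J` (offset coins the block never reads); a classical block (oracle gates allowed)
writing, relative to the oracle `A`, a work-register content that separates exactly the tuples of
shifted table values `F_u (Z_u − A_u(y) mod Q_u)`, `A_u(y) = ∑_{un j = u} y_j 2^{lev j}`. Then the
Born probability, relative to `A`, that the control read-out lies in `E` is
`∑_{γ ∈ E} ∑_c (∏_u unitWeight_u (c_u)) ∏_j testWeight (γ_j) (σ_j) (2π c_{un j} 2^{lev j}/Q_{un j})`: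
a mixture over character vectors (weights `corrMass/Q²`, Shor's coset weights for periodic tables,
uniform for injective tables) of independent Hadamard tests with exact phases.
[cite: Kitaev1995, §3 (Lemma 8, Lemma 10) and §4; Shor1997, §5] -/
theorem sandwich_law {J : Type*} [Fintype J] (Lu : U → ℕ) (F : U → ℕ → Ω) (un : Fin k₁ → U)
    (lev : Fin k₁ → ℕ) (σ : Fin k₁ → Bool) (zv : QReg k₂ ≃ ((u : U) → Fin (Qof Lu u)) × J)
    (A : Language Bool) (V : QCircuit cliffordT (n + ((k₁ + k₂) + m))) (x : QReg n)
    (R : QReg k₁ → QReg k₂ → QReg m)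
    (hV : ∀ (y : QReg k₁) (Z : QReg k₂), V.toMatrix A *ᵥ basisState (coinInput x (Fin.append y Z)) =
      basisState (tri x (Fin.append y Z) (R y Z)))
    (hR : ∀ (Z : QReg k₂) (y y' : QReg k₁), R y Z = R y' Z ↔
      ∀ u, F u (shiftMod (Qof Lu u) (((zv Z).1 u : ℕ) - (trialExp un lev u y : ℤ))) =
        F u (shiftMod (Qof Lu u) (((zv Z).1 u : ℕ) - (trialExp un lev u y' : ℤ))))
    (E : Finset (QReg k₁)) :
    ∑ z ∈ univ.filter (fun z : QReg (n + ((k₁ + k₂) + m)) => (fun j => z (yWire n k₁ k₂ m j)) ∈ E),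
        ‖(sandwich V σ).runOn A (basisState (padInput x ((k₁ + k₂) + m))) z‖ ^ 2 =
      ∑ γ ∈ E, ∑ c : (u : U) → Fin (Qof Lu u),
        (∏ u, unitWeight Lu F u (c u)) * readWeight Lu un lev σ c γ := by
  classical
  rw [sandwich_prob_yEvent_eq A V σ x R hV E, mul_sum]
  refine sum_congr rfl fun γ _ => ?_
  -- reindex the offsets by (unit values, junk) and apply the autocorrelation Parseval identity
  -- for each junk value
  have hpars : ∀ jk : J, (∑ Zv : (u : U) → Fin (Qof Lu u), ∑ ρ : QReg m,
      ‖∑ y ∈ univ.filter (fun y => R y (zv.symm (Zv, jk)) = ρ), sPhase σ y * ySign y γ‖ ^ 2) =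
      (∏ u, (1 / (Qof Lu u : ℝ))) * ∑ c : (u : U) → Fin (Qof Lu u),
        (∏ u, corrMass (Qof Lu u) (F u) (c u : ℕ)) * ‖∑ y, (sPhase σ y * ySign y γ) *
          chrPi (Qof Lu) c (fun u => (trialExp un lev u y : ℤ))‖ ^ 2 := fun jk =>
    parseval_shift (Qof Lu) (Qof_pos Lu) F (fun u y => (trialExp un lev u y : ℤ))
      (fun Zv y => R y (zv.symm (Zv, jk))) (fun Zv y y' => by
        have h := hR (zv.symm (Zv, jk)) y y'
        rw [Equiv.apply_symm_apply] at h
        exact h) (fun y => sPhase σ y * ySign y γ)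
  have hreidx : (∑ Z : QReg k₂, ∑ ρ : QReg m,
      ‖∑ y ∈ univ.filter (fun y => R y Z = ρ), sPhase σ y * ySign y γ‖ ^ 2) =
      ∑ p : ((u : U) → Fin (Qof Lu u)) × J, ∑ ρ : QReg m,
        ‖∑ y ∈ univ.filter (fun y => R y (zv.symm p) = ρ), sPhase σ y * ySign y γ‖ ^ 2 :=
    Fintype.sum_equiv zv _ _ fun Z => by simp only [Equiv.symm_apply_apply]
  rw [hreidx, Fintype.sum_prod_type_right, sum_congr rfl fun jk _ => hpars jk, sum_const, card_univ,
    nsmul_eq_mul, mul_sum, mul_sum, mul_sum]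
  refine sum_congr rfl fun c _ => ?_
  rw [← norm_sq_charSum Lu un lev σ c γ]
  -- the constants: `2^{-k₂} · |J| = ∏_u Q_u⁻¹`
  have hcard := two_pow_eq_prod_Qof Lu zv
  have h2 : (0 : ℝ) < (2 : ℝ) ^ k₂ := by positivity
  have hP : (∏ u, (Qof Lu u : ℝ)) ≠ 0 := by
    intro h0
    rw [h0, zero_mul] at hcard
    exact h2.ne' hcard
  have hJ : (Fintype.card J : ℝ) ≠ 0 := by
    intro h0
    rw [h0, mul_zero] at hcard
    exact h2.ne' hcard
  have h1 : (∏ u, (1 / (Qof Lu u : ℝ))) = 1 / ∏ u, (Qof Lu u : ℝ) := by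
    rw [prod_div_distrib, prod_const_one]
  have h2 : (∏ u, unitWeight Lu F u (c u)) =
      (∏ u, corrMass (Qof Lu u) (F u) (c u : ℕ)) / (∏ u, (Qof Lu u : ℝ)) ^ 2 := by
    unfold unitWeight
    rw [prod_div_distrib, prod_pow]
  have h3 : (1 / 2 : ℝ) ^ (k₁ + k₂) =
      (1 / 2 : ℝ) ^ k₁ * (1 / ((∏ u, (Qof Lu u : ℝ)) * Fintype.card J)) := by
    rw [pow_add, one_div_pow (2 : ℝ) k₂, hcard]
  rw [h1, h2, h3]
  field_simp

end law



end PeriodFinding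

end Literature.Computability.Cryptography

end
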